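import Summits.BirchSwinnertonDyer.Rank1Residual.X11b.AnticyclotomicControlCokernel
import HarnessLib

/-!
# Crux K1 `CumulativeHeegnerInclusionAtThree` (stmt-BirchSwinnertonDyer-24198) / crux A (stmt-26896): the
# port [P-ctl] — anticyclotomic CONTROL AT EVERY LAYER `K_n` of the `ℤ_p`-tower, Selmer formulation, I:
# generic discrete modules (any number field `K`, any prime `p`, any `ℤ_p`-extension `κ`, any layer `n`)

Width seat bsd-line-chl-k1-p1-w8 (`--supports stmt-BirchSwinnertonDyer-24198`). THEOREMS ONLY (no definition,
no named fact, no `sorry`); ROUTE-INDEPENDENT (no `Theses` import). This is the port named `[P-ctl]` in the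
K1 lead's census (crux dir `A26896-LINE-CENSUS-g6.md` §2–§3, `LAYER-TOWER-DOOR-w2g5.md` §2 step [P]): the
layer-tower line (LT) for A reads an equivariant Kolyvagin bound at layer `n` through the control map

  `s_n : Sel_𝔭^Σ(K_n, M) → Sel_𝔭^Σ(K_∞, M)^{Γ_n}`,  `Γ_n = Gal(K_∞/K_n) ∋ γ^{pⁿ}`,

which the tree so far carried only at the bottom layer `n = 0`
(`X11b.AcSelmer.controlMap_bijective_of_local_descent`). Here the same statements are proved at EVERY layer
`n`, in the tree's vocabulary `selmerOver (κ.layerSubgroup n) M p 𝔭 Σ = Sel_𝔭^Σ(K_n, M)`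
(`K_n = \bar K^{κ⁻¹(pⁿℤ_p)}`), `resOfLe`, `conjH1` — with NO new definition (`s_n` is
`resOfLe M (κ.kerSubgroup_le_layerSubgroup n)` itself):

* §0–§1 `γ^{pⁿ} ∈ Gal(\bar K/K_n)` for every `γ`; `res_{K_n → K_∞}` maps `Sel_𝔭^Σ(K_n, M)` into `Sel_𝔭^Σ(K_∞, M)`
  with image fixed by `conj_σ`, `σ ∈ Gal(\bar K/K_n)` (`resOfLe_layer_mem_selmerOver`, `conjH1_resOfLe_layer`).
* §2 `s_n` is INJECTIVE when `M^{Gal(\bar K/K_∞)} = 0` (inflation–restriction with `H¹(Γ_n, 0) = 0`, tree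
  `AcSelmer.resOfLe_injective_of_fixedPoints`): `resOfLe_layer_injective_of_fixedPoints`.
* §3 the STRICT condition at `𝔭` DESCENDS from `K_∞` to `K_n` when `M^{D_𝔭 ⊓ ker κ} = 0`
  (`mem_strictKer_layer_of_resOfLe_mem`; layer-`n` copy of `AcSelmer.mem_strictKer_top_of_resOfLe_mem`).
* §4 which lifts lie in `Sel_𝔭^Σ(K_n, M)`: only the AWAY and INFINITE conditions matter
  (`mem_selmerOver_layer_iff_away_inf`).
* §5 the descent is AUTOMATIC at every place whose decomposition group lies in `ker κ` (split completely in
  `K_∞`): `resOfLe_mem_awayKer_iff_of_decomp_le_of_le`, `resOfLe_mem_infKer_iff_of_decompInf_le_of_le`,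
  `awayCondition_descends_layer_of_decomp_le`.
* §6 `s_n` is SURJECTIVE modulo local descent: Greenberg's Lemma 3.2 at layer `n` (tree
  `ZpExtension.mem_range_resOfLe_of_conjH1_eq`, the `cd_p ℤ_p = 1` cocycle argument) + §4:
  `exists_mem_selmerOver_layer_resOfLe_eq_of_local_descent`.

Companion II (`…LayerControlCurve`): elliptic curves over a totally complex `K`. What is NOT here: the local
kernels at the finitely decomposed `v ∤ p`, the dual/Fitting packaging `C_n → X/ω_n X → X_n → 0`, any Kolyvagin
system, reciprocity law or `L`-function. Crux A (26896) and K1 (24198) stay OPEN; BSD is not proved by any of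
this; no summit statement is proved by this seat.

References: [GreenbergLNM1716] §3 Lemmas 3.1–3.3 and p. 90 (the control diagram at layer `n`: `s_n`, `h_n`,
`g_n`); [JetchevSkinnerWan2017] §3.3 (shape only); [Castella2018] Def. 2.2 (arXiv:1704.06608 p. 5);
[SerreGaloisCohomology1997] I.§2.6 (b), I.§3.4; [MazurTate1987] §1; [BertoliniDarmon1990] §2.
-/

set_option linter.dupNamespace false
set_option autoImplicit false

noncomputable section

open scoped Classical

namespace Summit.BirchSwinnertonDyer.BirchSwinnertonDyer.Theorems.CumulativeHeegnerInclusionAtThreeLayerControl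

open NumberField IsDedekindDomain Field
open Literature.NumberTheory.EllipticCurves Literature.NumberTheory.EllipticCurves.GreenbergSelmer
open Literature.NumberTheory.GaloisRepresentations
open Summit.BirchSwinnertonDyer.Rank1Residual.X11b Summit.BirchSwinnertonDyer.Rank1Residual.X11b.AcSelmer

universe u

section Generic

variable {K : Type u} [Field K] [NumberField K] {p : ℕ} [Fact p.Prime] (κ : ZpExtension K p)

/-! ## §0 The layer subgroups `Γ_K ⊇ κ⁻¹(pⁿℤ_p) = Gal(\bar K/K_n) ⊇ ker κ = Gal(\bar K/K_∞)` -/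

omit [NumberField K] in
/-- **`γ^{pⁿ} ∈ Gal(\bar K/K_n)` for EVERY `γ ∈ Γ_K`** (no topological-generator hypothesis):
`κ(γ^{pⁿ}) = pⁿ·κ(γ) ∈ pⁿℤ_p`. [cite: Washington1997, §13.1] [cite: GreenbergLNM1716, §1 p. 60 (`Γ_n = Γ^{pⁿ}`)] -/
theorem pow_prime_pow_mem_layerSubgroup (γ : absoluteGaloisGroup K) (n : ℕ) :
    γ ^ p ^ n ∈ κ.layerSubgroup n := by
  rw [ZpExtension.mem_layerSubgroup, map_pow, toAdd_pow, nsmul_eq_mul, Nat.cast_pow]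
  exact Dvd.intro _ rfl

/-! ## §1 `s_n` is well defined: `res_{K_n→K_∞}` maps `Sel_𝔭^Σ(K_n, M)` into `Sel_𝔭^Σ(K_∞, M)^{Γ_n}` -/

variable {M : Type u} [AddCommGroup M] [DistribMulAction (absoluteGaloisGroup K) M]
  [TopologicalSpace M] [DiscreteTopology M]

/-- **`res_{K_n → K_∞}` maps `Sel_𝔭^Σ(K_n, M)` into `Sel_𝔭^Σ(K_∞, M)`** (functoriality of Castella's local
conditions under restriction, tree `resOfLe_mem_selmerOver`, for the normal subgroups
`ker κ ≤ κ⁻¹(pⁿℤ_p)`). [cite: GreenbergLNM1716, §3 p. 85 (`s_n`)] [cite: Castella2018, Def. 2.2 (arXiv:1704.06608 p. 5)] -/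
theorem resOfLe_layer_mem_selmerOver (n : ℕ) {𝔭 : HeightOneSpectrum (𝓞 K)}
    {S : Set (HeightOneSpectrum (𝓞 K))} {c : subgroupH1 (κ.layerSubgroup n) M}
    (hc : c ∈ selmerOver (κ.layerSubgroup n) M p 𝔭 S) :
    resOfLe M (κ.kerSubgroup_le_layerSubgroup n) c ∈ selmerOver κ.kerSubgroup M p 𝔭 S :=
  resOfLe_mem_selmerOver (κ.kerSubgroup_le_layerSubgroup n) hc

omit [NumberField K] in
/-- **Classes restricted from `K_n` are `Γ_n`-invariant**: for `σ ∈ Gal(\bar K/K_n)` and `c ∈ H¹(K_n, M)`,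
`conj_σ (res_{K_n→K_∞} c) = res_{K_n→K_∞} c` — `conj_σ` on `H¹(κ⁻¹(pⁿℤ_p), M)` is the identity (inner
automorphisms act trivially, tree `conjH1_of_mem_holds`) and commutes with restriction
(`resOfLe_comp_conjH1_holds`). Greenberg's "the image of `h_n` is fixed by `Γ_n`".
[cite: SerreLocalFields1979, VII.§5 Prop. 3] [cite: GreenbergLNM1716, §3 p. 85] -/
theorem conjH1_resOfLe_layer (n : ℕ) {σ : absoluteGaloisGroup K} (hσ : σ ∈ κ.layerSubgroup n)
    (c : subgroupH1 (κ.layerSubgroup n) M) :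
    conjH1 κ.kerSubgroup M σ (resOfLe M (κ.kerSubgroup_le_layerSubgroup n) c) =
      resOfLe M (κ.kerSubgroup_le_layerSubgroup n) c := by
  rw [← AddMonoidHom.comp_apply,
    ← resOfLe_comp_conjH1_holds (M := M) (κ.kerSubgroup_le_layerSubgroup n) σ,
    AddMonoidHom.comp_apply, conjH1_of_mem_holds (κ.layerSubgroup n) M hσ, AddMonoidHom.id_apply]

omit [NumberField K] in
/-- In particular `conj_{γ^{pⁿ}}` fixes `res_{K_n→K_∞} c` for EVERY `γ ∈ Γ_K`.
[cite: GreenbergLNM1716, §3 p. 85 (`Γ_n = Γ^{pⁿ}`)] -/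
theorem conjH1_pow_resOfLe_layer (n : ℕ) (γ : absoluteGaloisGroup K)
    (c : subgroupH1 (κ.layerSubgroup n) M) :
    conjH1 κ.kerSubgroup M (γ ^ p ^ n) (resOfLe M (κ.kerSubgroup_le_layerSubgroup n) c) =
      resOfLe M (κ.kerSubgroup_le_layerSubgroup n) c :=
  conjH1_resOfLe_layer κ n (pow_prime_pow_mem_layerSubgroup κ γ n) c

/-! ## §2 `s_n` is injective when `M^{Gal(\bar K/K_∞)} = 0` -/

omit [NumberField K] in
/-- **`res_{K_n → K_∞} : H¹(K_n, M) → H¹(K_∞, M)` is INJECTIVE at every layer `n` when `M` has no non-zero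
element fixed by `Gal(\bar K/K_∞) = ker κ`** (e.g. `M = E[p^∞]` with `E(K_∞)[p^∞] = 0`): inflation–restriction,
`ker = H¹(Gal(K_∞/K_n), M^{ker κ}) = H¹(Γ_n, 0) = 0`, on cocycles (tree `AcSelmer.resOfLe_injective_of_fixedPoints`;
`ker κ` is normal in `Γ_K`, hence in `κ⁻¹(pⁿℤ_p)`). Greenberg's Lemma 3.1 with `B = 0` at layer `n`.
[cite: GreenbergLNM1716, §3 Lemma 3.1 (p. 86)] [cite: SerreGaloisCohomology1997, I.§2.6 (b)] -/
theorem resOfLe_layer_injective_of_fixedPoints (n : ℕ)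
    (hcont : ∀ m : M, Continuous fun g : absoluteGaloisGroup K ↦ g • m)
    (h0 : ∀ m : M, (∀ x ∈ κ.kerSubgroup, x • m = m) → m = 0) :
    Function.Injective (resOfLe M (κ.kerSubgroup_le_layerSubgroup n)) :=
  resOfLe_injective_of_fixedPoints (κ.kerSubgroup_le_layerSubgroup n) inferInstance hcont h0

omit [NumberField K] in
/-- Hence **`s_n` is injective on `Sel_𝔭^Σ(K_n, M)`**: two Selmer classes over `K_n` with the same
restriction to `K_∞` are equal. [cite: GreenbergLNM1716, §3 Lemma 3.1 (p. 86), "`ker(s_n) ⊆ ker(h_n)`"] -/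
theorem eq_of_resOfLe_layer_eq_of_fixedPoints (n : ℕ)
    (hcont : ∀ m : M, Continuous fun g : absoluteGaloisGroup K ↦ g • m)
    (h0 : ∀ m : M, (∀ x ∈ κ.kerSubgroup, x • m = m) → m = 0)
    {c c' : subgroupH1 (κ.layerSubgroup n) M}
    (h : resOfLe M (κ.kerSubgroup_le_layerSubgroup n) c =
      resOfLe M (κ.kerSubgroup_le_layerSubgroup n) c') : c = c' :=
  resOfLe_layer_injective_of_fixedPoints κ n hcont h0 h

/-! ## §3 The strict condition at `𝔭` descends from `K_∞` to `K_n` -/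

/-- **Strict descent at layer `n`.** For a discrete `Γ_K`-module `M` with continuous orbit maps and NO
non-zero element fixed by `D_𝔭 ⊓ ker κ` (`E(K_{∞,w})[p^∞] = 0`), and `c ∈ H¹(K_n, M)`: if `res_{K_n→K_∞} c`
satisfies Castella's strict condition at (the chosen place above) `𝔭` over `K_∞`, then `c` satisfies it over
`K_n`. Proof: `strictMap_{ker κ} ∘ res = res_{(Γ_n ⊓ D_𝔭) → (ker κ ⊓ D_𝔭)} ∘ strictMap_{Γ_n}`
(`strictMap_comp_resOfLe`) and the right-hand restriction is injective (`resOfLe_injective_of_fixedPoints`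
for the `D_𝔭`-module `M ⧸ 0`). The `𝔭`-component of `ker g_n` in the layer-`n` control diagram vanishes.
[cite: GreenbergLNM1716, §3 pp. 85–86 (`ker g_n`)] [cite: JetchevSkinnerWan2017, §3.3 (control; shape only)] -/
theorem mem_strictKer_layer_of_resOfLe_mem (n : ℕ) (𝔭 : HeightOneSpectrum (𝓞 K))
    (hcont : ∀ m : M, Continuous fun g : absoluteGaloisGroup K ↦ g • m)
    (h0 : ∀ m : M, (∀ x ∈ decomp 𝔭 ⊓ κ.kerSubgroup, x • m = m) → m = 0)
    {c : subgroupH1 (κ.layerSubgroup n) M}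
    (hc : resOfLe M (κ.kerSubgroup_le_layerSubgroup n) c ∈
      (strictDatum M 𝔭).strictKer κ.kerSubgroup) :
    c ∈ (strictDatum M 𝔭).strictKer (κ.layerSubgroup n) := by
  rw [LocalDatum.mem_strictKer_iff] at hc ⊢
  rw [← AddMonoidHom.comp_apply,
    strictMap_comp_resOfLe (κ.kerSubgroup_le_layerSubgroup n) (strictDatum M 𝔭),
    AddMonoidHom.comp_apply] at hc
  -- the restriction `H¹(decompIn Γ_n 𝔭, Gr) → H¹(decompIn (ker κ) 𝔭, Gr)` is injective
  have hnormal : ((decompIn κ.kerSubgroup 𝔭).subgroupOf (decompIn (κ.layerSubgroup n) 𝔭)).Normal := by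
    rw [Subgroup.normal_subgroupOf_iff (decompIn_mono (κ.kerSubgroup_le_layerSubgroup n) 𝔭)]
    intro x g hx _
    rw [mem_decompIn_iff] at hx ⊢
    rw [ZpExtension.mem_kerSubgroup] at hx ⊢
    rw [Subgroup.coe_mul, Subgroup.coe_mul, Subgroup.coe_inv, map_mul, map_mul, map_inv, hx,
      mul_one, mul_inv_cancel]
  have hcontGr : ∀ q : (strictDatum M 𝔭).Gr, Continuous fun δ : decomp 𝔭 ↦ δ • q := fun q ↦ by
    obtain ⟨m, rfl⟩ := (strictDatum M 𝔭).grMk_surjective q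
    have e : (fun δ : decomp 𝔭 ↦ δ • (strictDatum M 𝔭).grMk m) =
        (strictDatum M 𝔭).grMk ∘ (fun g : absoluteGaloisGroup K ↦ g • m) ∘ Subtype.val := by
      funext δ; rw [LocalDatum.smul_grMk]; rfl
    rw [e]
    exact continuous_of_discreteTopology.comp ((hcont m).comp continuous_subtype_val)
  have hinj := resOfLe_injective_of_fixedPoints (G := decomp 𝔭) (M := (strictDatum M 𝔭).Gr)
    (decompIn_mono (κ.kerSubgroup_le_layerSubgroup n) 𝔭) hnormal hcontGr fun q hq ↦
      strictDatum_gr_eq_zero_of_fixed 𝔭 (decomp 𝔭 ⊓ κ.kerSubgroup) inf_le_left h0 q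
        fun x hx ↦ hq x ((mem_decompIn_iff _ _ x).2 (Subgroup.mem_inf.mp hx).2)
  exact (injective_iff_map_eq_zero _).mp hinj _ hc

/-- **The strict condition at `𝔭`, layer `n`: over `K_∞` after restriction IFF over `K_n`.**
[cite: GreenbergLNM1716, §3 pp. 85–86] -/
theorem resOfLe_layer_mem_strictKer_iff (n : ℕ) (𝔭 : HeightOneSpectrum (𝓞 K))
    (hcont : ∀ m : M, Continuous fun g : absoluteGaloisGroup K ↦ g • m)
    (h0 : ∀ m : M, (∀ x ∈ decomp 𝔭 ⊓ κ.kerSubgroup, x • m = m) → m = 0)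
    (c : subgroupH1 (κ.layerSubgroup n) M) :
    resOfLe M (κ.kerSubgroup_le_layerSubgroup n) c ∈ (strictDatum M 𝔭).strictKer κ.kerSubgroup ↔
      c ∈ (strictDatum M 𝔭).strictKer (κ.layerSubgroup n) :=
  ⟨mem_strictKer_layer_of_resOfLe_mem κ n 𝔭 hcont h0,
    resOfLe_mem_strictKer (κ.kerSubgroup_le_layerSubgroup n) _⟩

/-! ## §4 The image of `s_n`: only the away and infinite conditions matter -/

/-- **Which lifts lie in `Sel_𝔭^Σ(K_n, M)`.** For `c ∈ H¹(K_n, M)` whose restriction to `K_∞` lies in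
`Sel_𝔭^Σ(K_∞, M)`, and `M` with no non-zero element fixed by `D_𝔭 ⊓ ker κ`: `c ∈ Sel_𝔭^Σ(K_n, M)` IFF every
conjugate `conj_σ c` (`σ ∈ Γ_K`: all places of `K_n` above `v`) satisfies the AWAY conditions (finite
`v ∉ Σ`, `v ∤ p`) and the INFINITE conditions over `K_n` — the strict conditions at the places above `𝔭`
descend (§3 applied to `conj_σ c`, whose restriction `conj_σ (res c)` is again a Selmer class over `K_∞`).
[cite: GreenbergLNM1716, §3 pp. 85–86 (`ker g_n`)] [cite: JetchevSkinnerWan2017, §3.3 (control; shape only)] -/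
theorem mem_selmerOver_layer_iff_away_inf (n : ℕ) (𝔭 : HeightOneSpectrum (𝓞 K))
    (S : Set (HeightOneSpectrum (𝓞 K)))
    (hcont : ∀ m : M, Continuous fun g : absoluteGaloisGroup K ↦ g • m)
    (h0 : ∀ m : M, (∀ x ∈ decomp 𝔭 ⊓ κ.kerSubgroup, x • m = m) → m = 0)
    {c : subgroupH1 (κ.layerSubgroup n) M}
    (hc : resOfLe M (κ.kerSubgroup_le_layerSubgroup n) c ∈ selmerOver κ.kerSubgroup M p 𝔭 S) :
    c ∈ selmerOver (κ.layerSubgroup n) M p 𝔭 S ↔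
      (∀ v : HeightOneSpectrum (𝓞 K), ((p : ℕ) : 𝓞 K) ∉ v.asIdeal → v ∉ S →
          ∀ σ : absoluteGaloisGroup K,
            conjH1 (κ.layerSubgroup n) M σ c ∈ awayKer (κ.layerSubgroup n) M v) ∧
        ∀ (w : InfinitePlace K) (σ : absoluteGaloisGroup K),
          conjH1 (κ.layerSubgroup n) M σ c ∈ infKer (κ.layerSubgroup n) M w := by
  rw [mem_selmerOver_iff]
  constructor
  · rintro ⟨ha, hi, -⟩
    exact ⟨ha, hi⟩
  · rintro ⟨ha, hi⟩
    refine ⟨ha, hi, fun σ ↦ ?_⟩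
    -- `res (conj_σ c) = conj_σ (res c)` is a Selmer class over `K_∞`, strict at `𝔭`
    have e : resOfLe M (κ.kerSubgroup_le_layerSubgroup n) (conjH1 (κ.layerSubgroup n) M σ c) =
        conjH1 κ.kerSubgroup M σ (resOfLe M (κ.kerSubgroup_le_layerSubgroup n) c) := by
      rw [← AddMonoidHom.comp_apply,
        resOfLe_comp_conjH1_holds (M := M) (κ.kerSubgroup_le_layerSubgroup n) σ,
        AddMonoidHom.comp_apply]
    have hσc : resOfLe M (κ.kerSubgroup_le_layerSubgroup n) (conjH1 (κ.layerSubgroup n) M σ c) ∈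
        selmerOver κ.kerSubgroup M p 𝔭 S := by
      rw [e]; exact conjH1_mem_selmerOver σ hc
    have hstrict := ((mem_selmerOver_iff _).mp hσc).2.2 1
    rw [conjH1_one_holds, AddMonoidHom.id_apply] at hstrict
    exact mem_strictKer_layer_of_resOfLe_mem κ n 𝔭 hcont h0 hstrict

/-! ## §5 Where the local conditions descend trivially: decomposition group inside `ker κ` -/

omit [NumberField K] in
/-- Restriction between subgroups with the SAME intersection with `D`: for `D ≤ H ≤ H'`, a class of
`H¹(H', M)` dies on `H' ⊓ D` iff its restriction to `H` dies on `H ⊓ D` (`H ⊓ D = D = H' ⊓ D` up to the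
injective restriction between equal subgroups, `resOfLe_injective_of_ge`). [folklore] -/
theorem resOfLe_resOfLe_inf_eq_zero_iff {H H' D : Subgroup (absoluteGaloisGroup K)} (h : H ≤ H')
    (hD : D ≤ H) (c : subgroupH1 H' M) :
    resOfLe M (inf_le_left : H ⊓ D ≤ H) (resOfLe M h c) = 0 ↔
      resOfLe M (inf_le_left : H' ⊓ D ≤ H') c = 0 := by
  have h1 : H ⊓ D ≤ H' ⊓ D := inf_le_inf_right _ h
  have h2 : H' ⊓ D ≤ H ⊓ D := fun g hg ↦
    Subgroup.mem_inf.mpr ⟨hD (Subgroup.mem_inf.mp hg).2, (Subgroup.mem_inf.mp hg).2⟩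
  have e : resOfLe M (inf_le_left : H ⊓ D ≤ H) (resOfLe M h c) =
      resOfLe M h1 (resOfLe M (inf_le_left : H' ⊓ D ≤ H') c) := by
    rw [← AddMonoidHom.comp_apply, ← AddMonoidHom.comp_apply, resOfLe_comp_holds, resOfLe_comp_holds]
  rw [e]
  refine ⟨fun hc ↦ (injective_iff_map_eq_zero _).mp (resOfLe_injective_of_ge M h1 h2) _ hc,
    fun hc ↦ by rw [hc, map_zero]⟩

/-- **At a finite place whose decomposition group lies in `H ≤ H'`** (e.g. `H = ker κ`, `H' = κ⁻¹(pⁿℤ_p)`,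
`v` split completely in `K_∞/K`): local triviality at the chosen place above `v` over `\bar K^H` after
restriction IFF over `\bar K^{H'}`. Layer-`n` form of `AcSelmer.resOfLe_mem_awayKer_iff_of_decomp_le`.
[cite: GreenbergLNM1716, §3 p. 87 (primes that split completely)] -/
theorem resOfLe_mem_awayKer_iff_of_decomp_le_of_le {H H' : Subgroup (absoluteGaloisGroup K)}
    (h : H ≤ H') (v : HeightOneSpectrum (𝓞 K)) (hD : decomp v ≤ H) (c : subgroupH1 H' M) :
    resOfLe M h c ∈ awayKer H M v ↔ c ∈ awayKer H' M v := by
  rw [awayKer, awayKer, AddMonoidHom.mem_ker, AddMonoidHom.mem_ker]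
  exact resOfLe_resOfLe_inf_eq_zero_iff h hD c

omit [NumberField K] in
/-- The same at an infinite place whose decomposition group lies in `H ≤ H'` (e.g. a complex place).
Layer-`n` form of `AcSelmer.resOfLe_mem_infKer_iff_of_decompInf_le`.
[cite: GreenbergLNM1716, §3 p. 87 (archimedean primes split completely)] -/
theorem resOfLe_mem_infKer_iff_of_decompInf_le_of_le {H H' : Subgroup (absoluteGaloisGroup K)}
    (h : H ≤ H') (w : InfinitePlace K) (hD : decompInf w ≤ H) (c : subgroupH1 H' M) :
    resOfLe M h c ∈ infKer H M w ↔ c ∈ infKer H' M w := by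
  rw [infKer, infKer, AddMonoidHom.mem_ker, AddMonoidHom.mem_ker]
  exact resOfLe_resOfLe_inf_eq_zero_iff h hD c

/-- **The AWAY condition descends to `K_n` at a finite `v` split completely in `K_∞`** (`D_v ≤ ker κ`, e.g. a
prime of an imaginary quadratic `K` inert over `ℚ` in the anticyclotomic tower): if `res_{K_n→K_∞} c` is a
Selmer class over `K_∞` then every conjugate `conj_σ c` is locally trivial at the chosen place above `v`
over `K_n` (`v ∉ Σ`, `v ∤ p`). [cite: GreenbergLNM1716, §3 p. 87 (primes that split completely)] -/
theorem awayCondition_descends_layer_of_decomp_le (n : ℕ) {𝔭 : HeightOneSpectrum (𝓞 K)}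
    {S : Set (HeightOneSpectrum (𝓞 K))} {v : HeightOneSpectrum (𝓞 K)} (hD : decomp v ≤ κ.kerSubgroup)
    (hv : ((p : ℕ) : 𝓞 K) ∉ v.asIdeal) (hvS : v ∉ S) {c : subgroupH1 (κ.layerSubgroup n) M}
    (hc : resOfLe M (κ.kerSubgroup_le_layerSubgroup n) c ∈ selmerOver κ.kerSubgroup M p 𝔭 S)
    (σ : absoluteGaloisGroup K) :
    conjH1 (κ.layerSubgroup n) M σ c ∈ awayKer (κ.layerSubgroup n) M v := by
  have e : resOfLe M (κ.kerSubgroup_le_layerSubgroup n) (conjH1 (κ.layerSubgroup n) M σ c) =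
      conjH1 κ.kerSubgroup M σ (resOfLe M (κ.kerSubgroup_le_layerSubgroup n) c) := by
    rw [← AddMonoidHom.comp_apply,
      resOfLe_comp_conjH1_holds (M := M) (κ.kerSubgroup_le_layerSubgroup n) σ, AddMonoidHom.comp_apply]
  have h := ((mem_selmerOver_iff _).mp (conjH1_mem_selmerOver σ hc)).1 v hv hvS 1
  rw [conjH1_one_holds, AddMonoidHom.id_apply, ← e] at h
  exact (resOfLe_mem_awayKer_iff_of_decomp_le_of_le (κ.kerSubgroup_le_layerSubgroup n) v hD _).mp h

/-! ## §6 `s_n` is surjective modulo local descent (Lemma 3.2 at layer `n`) -/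

/-- **Every `conj_{γ^{pⁿ}}`-fixed class of `Sel_𝔭^Σ(K_∞, M)` comes from `Sel_𝔭^Σ(K_n, M)`, modulo local descent**
(`M` discrete `p`-primary with continuous orbit maps, `κ` any `ℤ_p`-extension with topological generator
`γ`, any `𝔭`, `Σ`, `n`). Greenberg's Lemma 3.2 at layer `n` (tree `ZpExtension.mem_range_resOfLe_of_conjH1_eq`:
`coker (H¹(K_n, M) → H¹(K_∞, M)^{Γ_n}) = 0`, the `cd_p(ℤ_p) = 1` argument on cocycles) gives a lift
`c ∈ H¹(K_n, M)`; if `M^{D_𝔭 ⊓ ker κ} = 0` and the away conditions (`hS`) and the infinite conditions (`hinf`)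
hold for every such lift, then `c ∈ Sel_𝔭^Σ(K_n, M)` by §4.
[cite: GreenbergLNM1716, §3 Lemma 3.2 (p. 86) and p. 90] [cite: SerreGaloisCohomology1997, I.§3.4] -/
theorem exists_mem_selmerOver_layer_resOfLe_eq_of_local_descent (n : ℕ) {γ : absoluteGaloisGroup K}
    (hγ : κ.IsTopGenerator γ) (𝔭 : HeightOneSpectrum (𝓞 K)) (S : Set (HeightOneSpectrum (𝓞 K)))
    (hcont : ∀ m : M, Continuous fun g : absoluteGaloisGroup K ↦ g • m)
    (hprim : ∀ m : M, ∃ k : ℕ, p ^ k • m = 0)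
    (h0 : ∀ m : M, (∀ x ∈ decomp 𝔭 ⊓ κ.kerSubgroup, x • m = m) → m = 0)
    (hS : ∀ c : subgroupH1 (κ.layerSubgroup n) M,
      resOfLe M (κ.kerSubgroup_le_layerSubgroup n) c ∈ selmerOver κ.kerSubgroup M p 𝔭 S →
        ∀ v : HeightOneSpectrum (𝓞 K), ((p : ℕ) : 𝓞 K) ∉ v.asIdeal → v ∉ S →
          ∀ σ : absoluteGaloisGroup K,
            conjH1 (κ.layerSubgroup n) M σ c ∈ awayKer (κ.layerSubgroup n) M v)
    (hinf : ∀ c : subgroupH1 (κ.layerSubgroup n) M,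
      resOfLe M (κ.kerSubgroup_le_layerSubgroup n) c ∈ selmerOver κ.kerSubgroup M p 𝔭 S →
        ∀ (w : InfinitePlace K) (σ : absoluteGaloisGroup K),
          conjH1 (κ.layerSubgroup n) M σ c ∈ infKer (κ.layerSubgroup n) M w)
    {x : subgroupH1 κ.kerSubgroup M} (hx : x ∈ selmerOver κ.kerSubgroup M p 𝔭 S)
    (hfix : conjH1 κ.kerSubgroup M (γ ^ p ^ n) x = x) :
    ∃ c ∈ selmerOver (κ.layerSubgroup n) M p 𝔭 S,
      resOfLe M (κ.kerSubgroup_le_layerSubgroup n) c = x := by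
  obtain ⟨c, hc⟩ := ZpExtension.mem_range_resOfLe_of_conjH1_eq κ hγ n hcont hprim x hfix
  have hcSel : resOfLe M (κ.kerSubgroup_le_layerSubgroup n) c ∈ selmerOver κ.kerSubgroup M p 𝔭 S := by
    rw [hc]; exact hx
  exact ⟨c, (mem_selmerOver_layer_iff_away_inf κ n 𝔭 S hcont h0 hcSel).mpr
    ⟨hS c hcSel, hinf c hcSel⟩, hc⟩

end Generic

end Summit.BirchSwinnertonDyer.BirchSwinnertonDyer.Theorems.CumulativeHeegnerInclusionAtThreeLayerControl

end
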